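import Summits.CriticalPhenomena.CardyFormulaZ2.Theorems.ParafermionPrecompact.Negative.ParafermionPrecompactFalseOfBulkNondegenerate
import Literature.Probability.Percolation.InterfaceTraversalBoundData4

/-!
# Tightness of the bond-`ℤ²` interface along every admissible discretisation family
# (stub `stub_interfaceTight` of line `free-arc-touch-covariance-martingale`, crux stmt-CriticalPhenomena-10814)

Helper file for the crux `CardySusyWard.ParafermionFamiliesToSLESix` (stmt-CriticalPhenomena-10814).  The
registered stub `stub_interfaceTight` of the line `free-arc-touch-covariance-martingale` asks, for every
RECTILINEAR Dobrushin polygon `D` and every admissible family `Λ` (`IsFamily D Λ`), for eventual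
a.e.-measurability of the crux's interface functional and its tightness along the mesh filter
(`IsTightAlongMesh`).  Both hold for EVERY Dobrushin domain, with no rectilinearity, and are theorems of the
tree since `InterfaceTraversalBoundData4.lean` (Aizenman–Burchard, Duke Math. J. 99 (1999), Thm 1.2, from the
RSW traversal bounds of the medial exploration path, uniformly over admissible data):
`Literature.Probability.Percolation.isTightAlongMesh_bondInterfaceIn` and `measurable_bondInterfaceIn`.
The crux's interface functional (the `if dist … then γ else γ ∘ symm` re-orientation of
`medialExplorationCurve (Λ δ) ω`, pushed to `CurveClass ℂ`) is DEFINITIONALLY `bondInterfaceIn D (Λ δ) ω`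
(`iface_eq_bondInterfaceIn`, `rfl`), so this file is glue only:

* `interfaceTight_of_isFamily` — the stub's conclusion for every Dobrushin domain (registered one-line form
  `stub_interfaceTight_allDomains`); the skeleton closes `stub_interfaceTight` by
  `fun D _ Λ hΛ => interfaceTight_of_isFamily D Λ hΛ`.
-/

noncomputable section

namespace Summit.CriticalPhenomena.CardyFormulaZ2.Theorems.ParafermionFamiliesToSLESix.FreeArc

open scoped Topology
open Filter MeasureTheory Set
open Literature.Probability.LatticeModels Literature.Probability.Percolation
open Literature.Probability.RandomPlanarGeometry
open Summit.CriticalPhenomena.CardyFormulaZ2.Theorems.ParafermionPrecompact.Negative (IsFamily)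

/-- The crux's interface functional (verbatim: the medial exploration curve of `Λ δ` re-oriented `a → b`,
modulo reparametrisation) IS the tree's `bondInterfaceIn D (Λ δ)`, definitionally. [cite: Smirnov2007ICM, §2.1] -/
theorem iface_eq_bondInterfaceIn (D : DobrushinDomain) (Λ : ℝ → DiscreteDobrushin) (δ : ℝ)
    (ω : BondConfig (Site 2)) :
    CurveClass.mk
        (if dist (medialExplorationCurve (Λ δ) ω 0) (D.pt 0) ≤
            dist (medialExplorationCurve (Λ δ) ω 0) (D.pt 1)
          then (⟨medialExplorationCurve (Λ δ) ω⟩ : Curve ℂ)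
          else ⟨(medialExplorationCurve (Λ δ) ω).comp ⟨unitInterval.symm, unitInterval.continuous_symm⟩⟩) =
      bondInterfaceIn D (Λ δ) ω :=
  rfl

/-- **Tightness + eventual a.e.-measurability of the crux's interface functional along every family
satisfying the six crux hypotheses, for EVERY Dobrushin domain** (Aizenman–Burchard 1999, Thm 1.2, via the
tree theorems `isTightAlongMesh_bondInterfaceIn` / `measurable_bondInterfaceIn`; only the clauses
`(Λ δ).Ω = D.carrier`, `(Λ δ).δ = δ` and eventual admissibility of `IsFamily` are used).
[cite: AizenmanBurchardDuke1999, Thm 1.2] -/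
theorem interfaceTight_of_isFamily (D : DobrushinDomain) (Λ : ℝ → DiscreteDobrushin) (hΛ : IsFamily D Λ) :
    (∀ᶠ δ in 𝓝[>] (0:ℝ), AEMeasurable
        (fun ω : BondConfig (Site 2) => CurveClass.mk
          (if dist (medialExplorationCurve (Λ δ) ω 0) (D.pt 0) ≤
              dist (medialExplorationCurve (Λ δ) ω 0) (D.pt 1)
            then (⟨medialExplorationCurve (Λ δ) ω⟩ : Curve ℂ)
            else ⟨(medialExplorationCurve (Λ δ) ω).comp ⟨unitInterval.symm, unitInterval.continuous_symm⟩⟩))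
        (bondPercolation (zdGraph 2) half)) ∧
      IsTightAlongMesh (Ωδ := fun _ => BondConfig (Site 2))
        (fun δ ω => CurveClass.mk
          (if dist (medialExplorationCurve (Λ δ) ω 0) (D.pt 0) ≤
              dist (medialExplorationCurve (Λ δ) ω 0) (D.pt 1)
            then (⟨medialExplorationCurve (Λ δ) ω⟩ : Curve ℂ)
            else ⟨(medialExplorationCurve (Λ δ) ω).comp ⟨unitInterval.symm, unitInterval.continuous_symm⟩⟩))
        (fun _ => bondPercolation (zdGraph 2) half) := by
  refine ⟨Eventually.of_forall fun δ => ?_, ?_⟩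
  · exact (measurable_bondInterfaceIn D (Λ δ)).aemeasurable
  · exact isTightAlongMesh_bondInterfaceIn D Λ hΛ.1 hΛ.2.1 hΛ.2.2.2.2.2

/-- **Registered one-line form** (`stub_interfaceTight_allDomains` on stmt-CriticalPhenomena-10814): the
free-arc line's `stub_interfaceTight` with the (unused) rectilinearity hypothesis dropped.
[cite: AizenmanBurchardDuke1999, Thm 1.2] -/
theorem stub_interfaceTight_allDomains : ∀ (D : DobrushinDomain) (Λ : ℝ → DiscreteDobrushin), IsFamily D Λ → (∀ᶠ δ in 𝓝[>] (0:ℝ), AEMeasurable (fun ω : BondConfig (Site 2) => CurveClass.mk (if dist (medialExplorationCurve (Λ δ) ω 0) (D.pt 0) ≤ dist (medialExplorationCurve (Λ δ) ω 0) (D.pt 1) then (⟨medialExplorationCurve (Λ δ) ω⟩ : Curve ℂ) else ⟨(medialExplorationCurve (Λ δ) ω).comp ⟨unitInterval.symm, unitInterval.continuous_symm⟩⟩)) (bondPercolation (zdGraph 2) half)) ∧ IsTightAlongMesh (Ωδ := fun _ => BondConfig (Site 2)) (fun δ ω => CurveClass.mk (if dist (medialExplorationCurve (Λ δ) ω 0)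 (D.pt 0) ≤ dist (medialExplorationCurve (Λ δ) ω 0) (D.pt 1) then (⟨medialExplorationCurve (Λ δ) ω⟩ : Curve ℂ) else ⟨(medialExplorationCurve (Λ δ) ω).comp ⟨unitInterval.symm, unitInterval.continuous_symm⟩⟩)) (fun _ => bondPercolation (zdGraph 2) half) :=
  interfaceTight_of_isFamily

end Summit.CriticalPhenomena.CardyFormulaZ2.Theorems.ParafermionFamiliesToSLESix.FreeArc

end
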